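import Summits.QuantumFields.YangMills.Theorems.FirstExitWindowFirstExitWindowTailLFirstExitOne
import Summits.QuantumFields.YangMills.Theorems.SmallFieldWideningLargeFieldMassRefinementTailOfFirstExitTail
import Summits.QuantumFields.YangMills.Theorems.UnitScaleTiltHistoryTailLOfFirstExitTail

/-!
# Route `FirstExitWindow` — crux `FirstExitWindowTailL` (stmt-QuantumFields-26243) FROM ITS ONE REMAINING REGISTERED STUB `stub_firstExitDeep`
# (deep exits, `j ≥ 2`), the first averaged level being LANDED (`FirstExitWindow.stub_firstExitOne`, p614089); and the two downstream cruxes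
# r3 `LargeFieldMassRefinementTail` (stmt-QuantumFields-22884) and K2′ `HistoryTailL` (stmt-QuantumFields-19936) from that one stub
# (support file; width seat `ym-line-sfw-p2-w2` gen 16)

WHAT THIS IS NOT: the deep-exit stub (the text of the registered `stub_firstExitDeep`, hypothesis `hdeep` below, j ≥ 2 — per the line card the
small-field half of Bałaban's programme) is NOT proved; nothing here bears on the Yang–Mills mass gap; rung R3 (`YM3TorusSU2`) is a RECORD rung, not
the Clay statement, and stays open.  Bookkeeping only: merge the constants of the two exit regimes (`γ₁ = min`, `C = max`, `c = min`, `N = max`;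
`β_h ≥ 1` for `γ ≤ 1`), then compose with the landed certificates `…_of_firstExitWindowTailL`.

References: T. Bałaban, CMP 102 (1985) 255–275 [Balaban1985UV3] ((7) p.257, (71) p.273).
-/

noncomputable section

open MeasureTheory
open Literature.MathematicalPhysics.QuantumFieldTheory.Balaban1983to89
open Literature.MathematicalPhysics.QuantumFieldTheory.Balaban1983to89.T3ContinuumYM3Torus
open Literature.MathematicalPhysics.QuantumFieldTheory.Balaban1983to89.T3UnitScaleTilt
open Literature.MathematicalPhysics.QuantumFieldTheory.Balaban1983to89.T3UnitLawDensityEML (ℰp)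

namespace Summit.QuantumFields.YangMills.Theorems.FirstExitWindow

/-- Merging the constants of two tail bounds: for `β ≥ 1`, `0 ≤ C₁ ≤ C`, `N₁ ≤ N`, `c ≤ c₁` and `x ≥ 0`:
`C₁·β^{N₁}·e^{−c₁ x} ≤ C·β^{N}·e^{−c x}`. [folklore] -/
theorem tail_bound_mono {β C₁ C c₁ c x : ℝ} {N₁ N : ℕ} (hβ : 1 ≤ β) (hC₁ : 0 ≤ C₁) (hC : C₁ ≤ C) (hN : N₁ ≤ N)
    (hc : c ≤ c₁) (hx : 0 ≤ x) :
    C₁ * β ^ N₁ * Real.exp (-(c₁ * x)) ≤ C * β ^ N * Real.exp (-(c * x)) := by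
  have h1 : β ^ N₁ ≤ β ^ N := pow_le_pow_right₀ hβ hN
  have h2 : Real.exp (-(c₁ * x)) ≤ Real.exp (-(c * x)) := Real.exp_le_exp.mpr (by nlinarith)
  have hβ0 : 0 ≤ β ^ N := pow_nonneg (zero_le_one.trans hβ) N
  calc C₁ * β ^ N₁ * Real.exp (-(c₁ * x)) ≤ C₁ * β ^ N * Real.exp (-(c * x)) := by gcongr
    _ ≤ C * β ^ N * Real.exp (-(c * x)) := by gcongr

/-- `β_i = (γL^{-i})⁻¹ ≥ 1` for `0 < γ ≤ 1`, `L ≥ 1`. [cite: Balaban1985UV3, (3) p.256] -/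
theorem one_le_inv_coupling {L : ℕ} (hL : 1 ≤ L) {γ : ℝ} (hγ : 0 < γ) (hγ1 : γ ≤ 1) (i : ℕ) :
    1 ≤ (γ * ((L : ℝ)⁻¹) ^ i)⁻¹ := by
  have hL' : (1 : ℝ) ≤ L := by exact_mod_cast hL
  have hLi : 0 < ((L : ℝ)⁻¹) ^ i := pow_pos (inv_pos.mpr (by linarith)) i
  have hLi1 : ((L : ℝ)⁻¹) ^ i ≤ 1 := pow_le_one₀ (inv_nonneg.mpr (by linarith)) (inv_le_one_of_one_le₀ hL')
  rw [one_le_inv_iff₀]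
  exact ⟨mul_pos hγ hLi, by nlinarith⟩

/-- **THE CRUX FROM ITS ONE REMAINING STUB**: the registered deep-exit stub (`j ≥ 2`, hypothesis `hdeep`, text verbatim) together with the LANDED
first-level exit `stub_firstExitOne` (`j = 1`) give `FirstExitWindowTailL` — constants merged as `γ₁ = min`, `C = max`, `c = min`, `N = max`.
The skeleton's composition, landed as a helper. [cite: Balaban1985UV3, (7) p.257 and (71) p.273] -/
theorem firstExitWindowTailL_of_firstExitDeep
    (hdeep : ∀ (L : ℕ) (b₀ p₀ b₂ : ℝ), 0 < b₀ → 2 < p₀ → b₀ ≤ b₂ → ∃ (γ₁ C c : ℝ) (N : ℕ), 0 < γ₁ ∧ γ₁ ≤ 1 ∧ 0 < c ∧ 0 ≤ C ∧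
      ∀ (F : T3Family) (γ : ℝ), F.L = L → 0 < γ → γ ≤ γ₁ → ∀ (K j : ℕ), 2 ≤ j → j ≤ K → ∀ p : Plaq (F.P K) j,
        (gibbsK F ℰp γ K).real {U | (∀ k, k < j → PlaqSmall (θBal F.L γ b₀ p₀ (K - k))
            (Averaging.iter (fun i => BlockAveraging.blockAvg (P := F.P K) (j := i) ℰp) k U)) ∧
          PlaqSmall (θBal F.L γ b₂ p₀ (K - j)) (Averaging.iter (fun i => BlockAveraging.blockAvg (P := F.P K) (j := i) ℰp) j U) ∧
          θBal F.L γ b₀ p₀ (K - j) ≤ GaugeGroup.dist1 (GaugeField.plaqHol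
            (Averaging.iter (fun i => BlockAveraging.blockAvg (P := F.P K) (j := i) ℰp) j U) p)} ≤
        C * ((γ * ((F.L : ℝ)⁻¹) ^ (K - j))⁻¹) ^ N * Real.exp (-(c * B10.pFun b₀ p₀ (Real.sqrt (γ * ((F.L : ℝ)⁻¹) ^ (K - j))) ^ 2))) :
    Summit.QuantumFields.YangMills.Theses.FirstExitWindow.FirstExitWindowTailL := by
  intro L b₀ p₀ b₂ hb₀ hp₀ hb₂
  obtain ⟨γ₁, C₁, c₁, N₁, hγ₁, hγ₁1, hc₁, hC₁, h1⟩ := stub_firstExitOne L b₀ p₀ b₂ hb₀ hp₀ hb₂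
  obtain ⟨γ₂, C₂, c₂, N₂, hγ₂, hγ₂1, hc₂, hC₂, h2⟩ := hdeep L b₀ p₀ b₂ hb₀ hp₀ hb₂
  refine ⟨min γ₁ γ₂, max C₁ C₂, min c₁ c₂, max N₁ N₂, lt_min hγ₁ hγ₂, (min_le_left _ _).trans hγ₁1, lt_min hc₁ hc₂,
    fun F γ hFL hγ hle K j hj1 hjK p => ?_⟩
  have hγ1 : γ ≤ 1 := hle.trans ((min_le_left _ _).trans hγ₁1)
  have hL : 1 ≤ F.L := le_of_lt F.hL.2
  have hβ : 1 ≤ (γ * ((F.L : ℝ)⁻¹) ^ (K - j))⁻¹ := one_le_inv_coupling hL hγ hγ1 (K - j)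
  have hx : 0 ≤ B10.pFun b₀ p₀ (Real.sqrt (γ * ((F.L : ℝ)⁻¹) ^ (K - j))) ^ 2 := sq_nonneg _
  rcases Nat.lt_or_ge j 2 with hj | hj
  · obtain rfl : j = 1 := by omega
    exact (h1 F γ hFL hγ (hle.trans (min_le_left _ _)) K hjK p).trans
      (tail_bound_mono hβ hC₁ (le_max_left _ _) (le_max_left _ _) (min_le_left _ _) hx)
  · exact (h2 F γ hFL hγ (hle.trans (min_le_right _ _)) K j hj hjK p).trans
      (tail_bound_mono hβ hC₂ (le_max_right _ _) (le_max_right _ _) (min_le_right _ _) hx)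

/-- **r3 ⇐ THE DEEP-EXIT STUB ALONE**: `LargeFieldMassRefinementTail` (stmt-QuantumFields-22884) from the text of `stub_firstExitDeep` (via
`LargeFieldMassRefinementTailOfFirstExit.largeFieldMassRefinementTail_of_firstExitWindowTailL`).  Conditional certificate; nothing about the mass gap.
[cite: Balaban1985UV3, (7) p.257 and (71) p.273] -/
theorem largeFieldMassRefinementTail_of_firstExitDeep
    (hdeep : ∀ (L : ℕ) (b₀ p₀ b₂ : ℝ), 0 < b₀ → 2 < p₀ → b₀ ≤ b₂ → ∃ (γ₁ C c : ℝ) (N : ℕ), 0 < γ₁ ∧ γ₁ ≤ 1 ∧ 0 < c ∧ 0 ≤ C ∧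
      ∀ (F : T3Family) (γ : ℝ), F.L = L → 0 < γ → γ ≤ γ₁ → ∀ (K j : ℕ), 2 ≤ j → j ≤ K → ∀ p : Plaq (F.P K) j,
        (gibbsK F ℰp γ K).real {U | (∀ k, k < j → PlaqSmall (θBal F.L γ b₀ p₀ (K - k))
            (Averaging.iter (fun i => BlockAveraging.blockAvg (P := F.P K) (j := i) ℰp) k U)) ∧
          PlaqSmall (θBal F.L γ b₂ p₀ (K - j)) (Averaging.iter (fun i => BlockAveraging.blockAvg (P := F.P K) (j := i) ℰp) j U) ∧
          θBal F.L γ b₀ p₀ (K - j) ≤ GaugeGroup.dist1 (GaugeField.plaqHol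
            (Averaging.iter (fun i => BlockAveraging.blockAvg (P := F.P K) (j := i) ℰp) j U) p)} ≤
        C * ((γ * ((F.L : ℝ)⁻¹) ^ (K - j))⁻¹) ^ N * Real.exp (-(c * B10.pFun b₀ p₀ (Real.sqrt (γ * ((F.L : ℝ)⁻¹) ^ (K - j))) ^ 2))) :
    Summit.QuantumFields.YangMills.Theses.SmallFieldWidening.LargeFieldMassRefinementTail :=
  LargeFieldMassRefinementTailOfFirstExit.largeFieldMassRefinementTail_of_firstExitWindowTailL
    (firstExitWindowTailL_of_firstExitDeep hdeep)

/-- **K2′ `HistoryTailL` ⇐ THE DEEP-EXIT STUB ALONE**: `UnitScaleTilt.HistoryTailL` (stmt-QuantumFields-19936) from the text of `stub_firstExitDeep`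
(via `unitScaleTilt_historyTailL_of_firstExitWindowTailL`).  Conditional certificate; nothing about the mass gap. [cite: Balaban1985UV3, (7) p.257 and (71) p.273] -/
theorem unitScaleTilt_historyTailL_of_firstExitDeep
    (hdeep : ∀ (L : ℕ) (b₀ p₀ b₂ : ℝ), 0 < b₀ → 2 < p₀ → b₀ ≤ b₂ → ∃ (γ₁ C c : ℝ) (N : ℕ), 0 < γ₁ ∧ γ₁ ≤ 1 ∧ 0 < c ∧ 0 ≤ C ∧
      ∀ (F : T3Family) (γ : ℝ), F.L = L → 0 < γ → γ ≤ γ₁ → ∀ (K j : ℕ), 2 ≤ j → j ≤ K → ∀ p : Plaq (F.P K) j,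
        (gibbsK F ℰp γ K).real {U | (∀ k, k < j → PlaqSmall (θBal F.L γ b₀ p₀ (K - k))
            (Averaging.iter (fun i => BlockAveraging.blockAvg (P := F.P K) (j := i) ℰp) k U)) ∧
          PlaqSmall (θBal F.L γ b₂ p₀ (K - j)) (Averaging.iter (fun i => BlockAveraging.blockAvg (P := F.P K) (j := i) ℰp) j U) ∧
          θBal F.L γ b₀ p₀ (K - j) ≤ GaugeGroup.dist1 (GaugeField.plaqHol
            (Averaging.iter (fun i => BlockAveraging.blockAvg (P := F.P K) (j := i) ℰp) j U) p)} ≤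
        C * ((γ * ((F.L : ℝ)⁻¹) ^ (K - j))⁻¹) ^ N * Real.exp (-(c * B10.pFun b₀ p₀ (Real.sqrt (γ * ((F.L : ℝ)⁻¹) ^ (K - j))) ^ 2))) :
    Summit.QuantumFields.YangMills.Theses.UnitScaleTilt.HistoryTailL :=
  unitScaleTilt_historyTailL_of_firstExitWindowTailL (firstExitWindowTailL_of_firstExitDeep hdeep)

end Summit.QuantumFields.YangMills.Theorems.FirstExitWindow

end
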